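import Mathlib
import Summits.MatrixMultiplication.MatrixMultiplication.Theorems.SnSubsetDichotomyPolynomialSlackAtomsTrichotomy
import Summits.MatrixMultiplication.MatrixMultiplication.Theorems.SnSubsetDichotomyPolynomialSlackKeptSplitC
import Summits.MatrixMultiplication.MatrixMultiplication.Theorems.SnSubsetDichotomyPolynomialSlackHeavyMass
import Summits.MatrixMultiplication.MatrixMultiplication.Theorems.SnSubsetDichotomyPolynomialSlackPairHeavyMass
import Summits.MatrixMultiplication.MatrixMultiplication.Theorems.SnSubsetDichotomyPolynomialSlackStructureAtoms

/-!
# The 3/4 step: the structure theorem for pure violators, trichotomy version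

Crux `Summit.MatrixMultiplication.MatrixMultiplication.Theses.SnSubsetDichotomy.PolynomialSlack`
(item `stmt-MatrixMultiplication-8306`), level-one programme, line transport-split-hull (lead c10),
registered stub `pure_violator_volume_le_trichotomy`.
The trichotomy form of `pure_violator_volume_le_atoms` (c9, `…StructureAtoms`), with NO dense/sparse
case analysis: a parity-pure TPP triple `S, T, U ⊆ S_n` (`n ≥ 40`) with `F := n!√(n!)/N ≤ 8n`, a scale
`M ≥ 1` with `4096 M³ ≤ F²`, the level-one smallness `hsmall₁ ≤ 1/1000`, the cap `2 log F ≤ q log n + 5`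
(`q ≤ 3/2`) and the range conditions of `volume_le_of_atoms_trichotomy` at `Λ = 1200 (1+log n)²`
fibres over `S_{n-1}`: `|S||T||U| ≤ n^{1495/1000} · B`.

Proof.  The co-densities `K_A = n!/(|S||T|)`, `K_B = n!/(|T||U|)`, `K_C = n!/(|U||S|)` satisfy
`K_A K_B K_C = F² ≥ 4096 M³` (`codensity_prod_eq_sq`), so one of them is `≥ 16 M`; rotating the triple
cyclically (`TripleProductProperty.rotate`, all hypotheses being invariant) we may assume it is
`K_C` (`wlog`).  Then `kept_split_C` (with `L = 6(1+log n) ≥ log(4n K_C)`, `log_pair_le_six`) and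
`levelOneError_le` + `hsmall₁` give `1 - 1/1000 ≤ kept` for the heavy part `pC` of `dC` at
`θC = K_C/(nM) ≥ 16/n`; `pair_heavy_mass` gives heavy mass `≤ 200(1+log n)·6(1+log n) = Λ`;
`log K_A + log K_B + log K_C = log F² = 2 log F ≤ q log n + 5`; and `volume_le_of_atoms_trichotomy`
(with `δ = 1/1000`, `W = W₀ · B`) followed by `hr8 : W₀ ≤ n^{1495/1000}` concludes.
-/

namespace Summit.MatrixMultiplication.MatrixMultiplication.Theorems.PolynomialSlack

open scoped BigOperators
open Literature.Combinatorics.Additive (TripleProductProperty)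

-- `Summit.<Summit>.<Problem>` is the tree's mandated summit-side namespace (CONVENTIONS §2); for
-- this single-conjunct summit the two coincide, so each declaration silences `dupNamespace`.
set_option linter.dupNamespace false

/-- `K_A · K_B · K_C = F²`: the co-densities of the three quotients of a triple of non-empty sets
multiply to the square of `F = n!√(n!)/N`. [folklore] -/
theorem codensity_prod_eq_sq {n : ℕ} {S T U : Finset (Equiv.Perm (Fin n))}
    (hS0 : S.Nonempty) (hT0 : T.Nonempty) (hU0 : U.Nonempty) :
    (n.factorial : ℝ) / (S.card * T.card : ℕ) * ((n.factorial : ℝ) / (T.card * U.card : ℕ)) *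
        ((n.factorial : ℝ) / (U.card * S.card : ℕ)) =
      ((n.factorial : ℝ) * Real.sqrt (n.factorial : ℝ) / (S.card * T.card * U.card : ℕ)) ^ 2 := by
  have hf0 : (0 : ℝ) ≤ n.factorial := Nat.cast_nonneg _
  have hcS0 : (0 : ℝ) < S.card := by exact_mod_cast hS0.card_pos
  have hcT0 : (0 : ℝ) < T.card := by exact_mod_cast hT0.card_pos
  have hcU0 : (0 : ℝ) < U.card := by exact_mod_cast hU0.card_pos
  rw [div_pow, mul_pow, Real.sq_sqrt hf0]
  push_cast
  field_simp

set_option maxHeartbeats 1600000 in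
/-- **Structure theorem for pure violators, trichotomy version (3/4 step).** For `n ≥ 40`, a
parity-pure TPP triple of non-empty sets with `F = n!√(n!)/N ≤ 8n`, a scale `Msc ≥ 1` with
`4096 Msc³ ≤ F²`, the level-one smallness `hsmall₁ ≤ 1/1000`, the cap `2 log F ≤ q log n + 5`
(`q ≤ 3/2`) and the ranges `hr1 … hr8` of the trichotomy endgame at `Λ = 1200(1+log n)²`, every bound
`B` on the TPP volumes of `S_{n-1}` gives `|S||T||U| ≤ n^{1495/1000} · B`.  Proof: rotate so that
`K_C ≥ 16 Msc` (possible as `K_A K_B K_C = F² ≥ 4096 Msc³`), then `kept_split_C` (kept `≥ 1 - 1/1000`),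
`pair_heavy_mass` (heavy mass `≤ 1200(1+log n)²`), `log K_A + log K_B + log K_C = 2 log F`,
`volume_le_of_atoms_trichotomy` and `W = W₀ · B ≤ n^{1495/1000} B`. [folklore] -/
theorem pure_violator_volume_le_trichotomy {n : ℕ} (hn : 40 ≤ n) (B : ℕ)
    (hB : ∀ S' T' U' : Finset (Equiv.Perm (Fin (n - 1))), TripleProductProperty S' T' U' →
      S'.card * T'.card * U'.card ≤ B)
    {S T U : Finset (Equiv.Perm (Fin n))} (hTPP : TripleProductProperty S T U)
    (hS0 : S.Nonempty) (hT0 : T.Nonempty) (hU0 : U.Nonempty)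
    (hS : ∀ s ∈ S, ∀ s' ∈ S, Equiv.Perm.sign s = Equiv.Perm.sign s')
    (hT : ∀ t ∈ T, ∀ t' ∈ T, Equiv.Perm.sign t = Equiv.Perm.sign t')
    (hU : ∀ u ∈ U, ∀ u' ∈ U, Equiv.Perm.sign u = Equiv.Perm.sign u')
    (Msc q : ℝ) (hMsc : 1 ≤ Msc) (hq : q ≤ 3 / 2)
    (hM3 : 4096 * Msc ^ 3 ≤
      ((n.factorial : ℝ) * Real.sqrt (n.factorial : ℝ) / (S.card * T.card * U.card : ℕ)) ^ 2)
    (hF : (n.factorial : ℝ) * Real.sqrt (n.factorial : ℝ) / (S.card * T.card * U.card : ℕ) ≤ 8 * n)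
    (hsmall₁ : (n.factorial : ℝ) * Real.sqrt (n.factorial : ℝ) / (S.card * T.card * U.card : ℕ) *
        (Real.sqrt 6 / Real.sqrt ((n : ℝ) * ((n : ℝ) - 1)) +
          30 * Real.sqrt ((1 + Real.log n) * (6 * (1 + Real.log n)) / Msc) / Real.sqrt ((n : ℝ) - 1)) ≤
      1 / 1000)
    (hFq : 2 * Real.log ((n.factorial : ℝ) * Real.sqrt (n.factorial : ℝ) /
        (S.card * T.card * U.card : ℕ)) ≤ q * Real.log n + 5)
    (Λ ε₂ εm LK Φ₀ τ mR ε₁ h₁ M A₀ A₁ P W₀ : ℝ)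
    (hΛ : Λ = 1200 * (1 + Real.log n) ^ 2)
    (hε₂ : ε₂ = 1 / (1000 * Λ))
    (hεm : εm = ε₂ ^ 2 / (12 * (1 + Real.log n) * (2 + Real.log (1 / ε₂))))
    (hLK : LK = 3 / 2 * Real.log n + 5)
    (hΦ₀ : Φ₀ = 576 * (1 + Real.log n) * (2 * (Real.log 8 + LK + Real.log (1 / εm))) / εm ^ 3)
    (hτ : τ = 1 / (400 * Φ₀))
    (hmR : mR = ((⌊Real.logb 2 ((n : ℝ) ^ 2)⌋₊ + 1 : ℕ) : ℝ))
    (hε₁ : ε₁ = τ / (10 ^ 5 * Λ * (1 + Real.log n) * mR))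
    (hh₁ : h₁ = τ / (10 ^ 4 * Λ * mR ^ 2))
    (hM : M = 10 ^ 4 * Λ * mR ^ 2 / τ)
    (hA₀ : A₀ = 5000 * n * (1 + Real.log n) * (LK + Real.log (4 / ε₂)) / ε₂ ^ 2)
    (hA₁ : A₁ = (n : ℝ) ^ (1245 / 1000 : ℝ))
    (hP : P = A₀ ^ 2 * (n : ℝ) ^ (-(151 / 100 : ℝ)) / ε₁ ^ 2)
    (hW₀ : W₀ = 10 ^ 7 * (1 + Real.log n) ^ 2 * (LK + Real.log (4 / ε₂)) ^ 2 * n /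
          (ε₂ ^ 4 * h₁ ^ 2) +
        20 * (1 + M) * A₀ ^ 2 / (h₁ ^ 2 * n) + n * P + 20 * (1 + M) * A₁ ^ 2 / (h₁ ^ 2 * n))
    (hr1 : Real.log A₀ ≤ 101 / 100 * Real.log n) (hr2 : A₀ ≤ A₁)
    (hr3 : 32 ≤ ε₁ * (n : ℝ) ^ (245 / 1000 : ℝ))
    (hr4 : 2 * (2 * Λ / τ + 2) ^ 2 ≤ (n : ℝ))
    (hr5 : Real.log ((4 * Λ / τ + 2) / ε₁) ≤ Real.log n / 500)
    (hr6 : 2000 ≤ Real.log n) (hr7 : 2000 * Λ ≤ (n : ℝ))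
    (hr8 : W₀ ≤ (n : ℝ) ^ (1495 / 1000 : ℝ)) :
    ((S.card * T.card * U.card : ℕ) : ℝ) ≤ (n : ℝ) ^ (1495 / 1000 : ℝ) * B := by
  classical
  /- reduction to the case where `C = U⁻¹S` is the non-dense quotient: `16 Msc ≤ K_C` -/
  wlog hKC : 16 * Msc ≤ (n.factorial : ℝ) / (U.card * S.card : ℕ) generalizing S T U
  · have hNe' : ((T.card * U.card * S.card : ℕ) : ℝ) = ((S.card * T.card * U.card : ℕ) : ℝ) := by
      push_cast; ring
    have hNe'' : ((U.card * S.card * T.card : ℕ) : ℝ) = ((S.card * T.card * U.card : ℕ) : ℝ) := by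
      push_cast; ring
    by_cases hKA : 16 * Msc ≤ (n.factorial : ℝ) / (S.card * T.card : ℕ)
    · -- rotate once: `(T, U, S)` has third quotient `S⁻¹T`
      have h := this hTPP.rotate hT0 hU0 hS0 hT hU hS (by rw [hNe']; exact hM3)
        (by rw [hNe']; exact hF) (by rw [hNe']; exact hsmall₁) (by rw [hNe']; exact hFq) hKA
      rw [hNe'] at h
      exact h
    by_cases hKB : 16 * Msc ≤ (n.factorial : ℝ) / (T.card * U.card : ℕ)
    · -- rotate twice: `(U, S, T)` has third quotient `T⁻¹U`
      have h := this hTPP.rotate.rotate hU0 hS0 hT0 hU hS hT (by rw [hNe'']; exact hM3)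
        (by rw [hNe'']; exact hF) (by rw [hNe'']; exact hsmall₁) (by rw [hNe'']; exact hFq) hKB
      rw [hNe''] at h
      exact h
    -- all three quotients dense: impossible as `K_A K_B K_C = F² ≥ 4096 Msc³`
    exfalso
    rw [not_le] at hKA hKB hKC
    have hf0 : (0 : ℝ) < n.factorial := by exact_mod_cast n.factorial_pos
    have hα0 : (0 : ℝ) < (S.card * T.card : ℕ) := by exact_mod_cast Nat.mul_pos hS0.card_pos hT0.card_pos
    have hβ0 : (0 : ℝ) < (T.card * U.card : ℕ) := by exact_mod_cast Nat.mul_pos hT0.card_pos hU0.card_pos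
    have hKA0 : 0 < (n.factorial : ℝ) / (S.card * T.card : ℕ) := by positivity
    have hKB0 : 0 < (n.factorial : ℝ) / (T.card * U.card : ℕ) := by positivity
    have hKC0 : 0 ≤ (n.factorial : ℝ) / (U.card * S.card : ℕ) := by positivity
    have hMsc0 : 0 ≤ 16 * Msc := by linarith
    have h1 : (n.factorial : ℝ) / (S.card * T.card : ℕ) * ((n.factorial : ℝ) / (T.card * U.card : ℕ)) <
        16 * Msc * (16 * Msc) := mul_lt_mul'' hKA hKB hKA0.le hKB0.le
    have h2 : (n.factorial : ℝ) / (S.card * T.card : ℕ) * ((n.factorial : ℝ) / (T.card * U.card : ℕ)) *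
        ((n.factorial : ℝ) / (U.card * S.card : ℕ)) < 16 * Msc * (16 * Msc) * (16 * Msc) :=
      mul_lt_mul'' h1 hKC (by positivity) hKC0
    rw [codensity_prod_eq_sq hS0 hT0 hU0] at h2
    have e : 16 * Msc * (16 * Msc) * (16 * Msc) = 4096 * Msc ^ 3 := by ring
    linarith
  /- scalars -/
  have hn1 : 1 ≤ n := by omega
  have hn2 : 2 ≤ n := by omega
  have hnR : (40 : ℝ) ≤ n := by exact_mod_cast hn
  have hn0 : (0 : ℝ) < n := by linarith
  have hm0 : (0 : ℝ) < (n : ℝ) - 1 := by linarith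
  have hMsc0 : 0 < Msc := by linarith
  have hf0 : (0 : ℝ) < n.factorial := by exact_mod_cast n.factorial_pos
  have hG1 : 1 ≤ 1 + Real.log n := by
    have := Real.log_nonneg (show (1 : ℝ) ≤ n by linarith); linarith
  set G : ℝ := 1 + Real.log n with hG
  have hG0 : 0 < G := by linarith
  have hL1 : (1 : ℝ) ≤ 6 * G := by linarith
  have hB0 : (0 : ℝ) ≤ B := Nat.cast_nonneg _
  -- the volume, as a real
  have hcS0 : (0 : ℝ) < S.card := by exact_mod_cast hS0.card_pos
  have hcT0 : (0 : ℝ) < T.card := by exact_mod_cast hT0.card_pos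
  have hcU0 : (0 : ℝ) < U.card := by exact_mod_cast hU0.card_pos
  obtain ⟨N, hNdef⟩ : ∃ N : ℝ, N = (S.card : ℝ) * T.card * U.card := ⟨_, rfl⟩
  have hN0 : 0 < N := by rw [hNdef]; positivity
  have hNe : ((S.card * T.card * U.card : ℕ) : ℝ) = N := by rw [hNdef]; push_cast; ring
  obtain ⟨F, hFdef⟩ : ∃ F : ℝ, F = (n.factorial : ℝ) * Real.sqrt (n.factorial : ℝ) / N := ⟨_, rfl⟩
  have hF0 : 0 < F := by rw [hFdef]; positivity
  have hF8 : F ≤ 8 * n := by rw [hFdef, ← hNe]; exact hF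
  -- the three injectivities and pair sizes `≤ n!`
  have hinjA := injOn_quot_first hTPP hU0
  have hinjB := injOn_quot_second hTPP hS0
  have hinjC := injOn_quot_first hTPP.rotate.rotate hT0
  have hαle : ((S.card * T.card : ℕ) : ℝ) ≤ n.factorial := by
    exact_mod_cast card_mul_card_le_factorial_of_injOn hinjA
  have hβle : ((T.card * U.card : ℕ) : ℝ) ≤ n.factorial := by
    exact_mod_cast card_mul_card_le_factorial_of_injOn hinjB
  have hα0 : (0 : ℝ) < (S.card * T.card : ℕ) := by push_cast; positivity
  have hβ0 : (0 : ℝ) < (T.card * U.card : ℕ) := by push_cast; positivity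
  have hγ0 : (0 : ℝ) < (U.card * S.card : ℕ) := by push_cast; positivity
  -- the co-densities: `K_A K_B K_C = F²`, `K_A, K_B ≥ 1`, so `K_C ≤ F² ≤ 64 n²`
  have hKKK : (n.factorial : ℝ) / (S.card * T.card : ℕ) * ((n.factorial : ℝ) / (T.card * U.card : ℕ)) *
      ((n.factorial : ℝ) / (U.card * S.card : ℕ)) = F ^ 2 := by
    rw [codensity_prod_eq_sq hS0 hT0 hU0, hNe, ← hFdef]
  have hKA1 : 1 ≤ (n.factorial : ℝ) / (S.card * T.card : ℕ) := by rw [le_div_iff₀ hα0]; linarith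
  have hKB1 : 1 ≤ (n.factorial : ℝ) / (T.card * U.card : ℕ) := by rw [le_div_iff₀ hβ0]; linarith
  have hKC0 : 0 < (n.factorial : ℝ) / (U.card * S.card : ℕ) := by positivity
  have hF2up : F ^ 2 ≤ 64 * (n : ℝ) ^ 2 := by
    have h0 : 0 ≤ 8 * (n : ℝ) := by positivity
    calc F ^ 2 = F * F := sq F
      _ ≤ (8 * (n : ℝ)) * (8 * (n : ℝ)) := mul_le_mul hF8 hF8 hF0.le h0
      _ = 64 * (n : ℝ) ^ 2 := by ring
  have hKCF : (n.factorial : ℝ) / (U.card * S.card : ℕ) ≤ F ^ 2 := by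
    rw [← hKKK]
    calc (n.factorial : ℝ) / (U.card * S.card : ℕ)
        = 1 * 1 * ((n.factorial : ℝ) / (U.card * S.card : ℕ)) := by ring
      _ ≤ _ := by gcongr
  have hLC := log_pair_le_six hn2 hγ0 hKCF hF2up
  /- the threshold, the profiles and the heavy part of `C` -/
  set θC : ℝ := (n.factorial : ℝ) / ((U.card * S.card : ℕ) * n * Msc) with hθC
  have hθC16 : 16 / (n : ℝ) ≤ θC := by
    rw [hθC, div_le_div_iff₀ hn0 (by positivity)]
    have hKC' := hKC
    rw [le_div_iff₀ hγ0] at hKC'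
    have h1 := mul_le_mul_of_nonneg_right hKC' hn0.le
    calc 16 * (((U.card * S.card : ℕ) : ℝ) * n * Msc) = 16 * Msc * (U.card * S.card : ℕ) * n := by ring
      _ ≤ (n.factorial : ℝ) * n := h1
  set dA : Fin n → Fin n → ℝ := fun i j =>
    (((S ×ˢ T).filter fun st => st.2 j = st.1 i).card : ℝ) / (S.card * T.card : ℕ) with hdA
  set dB : Fin n → Fin n → ℝ := fun j k =>
    (((T ×ˢ U).filter fun tu => tu.2 k = tu.1 j).card : ℝ) / (T.card * U.card : ℕ) with hdB
  set dC : Fin n → Fin n → ℝ := fun k i =>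
    (((U ×ˢ S).filter fun us => us.2 i = us.1 k).card : ℝ) / (U.card * S.card : ℕ) with hdC
  set pC : Fin n → Fin n → ℝ := fun k i => if θC ≤ dC k i then dC k i - 1 / n else 0 with hpC
  /- (1) the kept inequality, with level-one error `≤ 1/1000` -/
  have hkept := kept_split_C hn hTPP hS0 hT0 hU0 hS hT hU dA dB dC pC (fun _ _ => rfl)
    (fun _ _ => rfl) (fun _ _ => rfl) Msc (6 * G) hMsc hL1 hKC hLC (fun _ _ => rfl)
  have herr := levelOneError_le hn2 N G (6 * G) Msc hN0
  rw [← hFdef] at herr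
  have hsmall₁' := hsmall₁
  rw [hNe, ← hFdef] at hsmall₁'
  rw [hNe, ← hFdef] at hkept
  have hkept' : 1 - 1 / 1000 ≤ -((n : ℝ) - 1) * ∑ i : Fin n, ∑ j : Fin n, ∑ k : Fin n,
      (dA i j - 1 / n) * (dB j k - 1 / n) * pC k i := by
    linarith
  /- (2) the heavy mass of `C` -/
  have hmassC : ∑ k : Fin n, ∑ i : Fin n, (if θC ≤ dC k i then dC k i else 0) ≤ Λ := by
    have h := pair_heavy_mass hn1 U S hU0 hS0 hinjC dC (fun _ _ => rfl) θC hθC16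
    refine h.trans ?_
    have h1 : 200 * G * Real.log (4 * n * n.factorial / (U.card * S.card : ℕ)) ≤ 200 * G * (6 * G) :=
      mul_le_mul_of_nonneg_left hLC (by positivity)
    rw [hΛ]
    linarith
  /- (3) the co-density cap -/
  have hQ : Real.log ((n.factorial : ℝ) / (S.card * T.card : ℕ)) +
      Real.log ((n.factorial : ℝ) / (T.card * U.card : ℕ)) +
      Real.log ((n.factorial : ℝ) / (U.card * S.card : ℕ)) ≤ q * Real.log n + 5 := by
    rw [← Real.log_mul (by positivity) (by positivity), ← Real.log_mul (by positivity) (by positivity),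
      hKKK, Real.log_pow]
    push_cast
    rw [hNe, ← hFdef] at hFq
    exact hFq
  /- (4) the atoms trichotomy theorem -/
  have hΛ1 : 1 ≤ Λ := by
    rw [hΛ]
    have h1 : (1 : ℝ) ≤ G ^ 2 := one_le_pow₀ hG1
    linarith
  have hmain := volume_le_of_atoms_trichotomy hn B hB hTPP hS0 hT0 hU0 dA dB dC pC (fun _ _ => rfl)
    (fun _ _ => rfl) (fun _ _ => rfl) θC Λ (1 / 1000) q hθC16 (fun _ _ => rfl) hΛ1 le_rfl hq hmassC
    hkept' hQ ε₂ εm LK Φ₀ τ mR ε₁ h₁ M A₀ A₁ P (W₀ * B) hε₂ hεm hLK hΦ₀ hτ hmR hε₁ hh₁ hM hA₀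
    hA₁ hP (by rw [hW₀]; ring) hr1 hr2 hr3 hr4 hr5 hr6 hr7
  exact hmain.trans (mul_le_mul_of_nonneg_right hr8 hB0)

end Summit.MatrixMultiplication.MatrixMultiplication.Theorems.PolynomialSlack
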